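import Summits.ValiantsHypothesis.ValiantsHypothesis.Theorems.LacunarySymmetroidMatrixDescartesCensusWindowN
import Summits.ValiantsHypothesis.ValiantsHypothesis.Theorems.LacunarySymmetroidMatrixDescartesCensusTopKillMult
import Summits.ValiantsHypothesis.ValiantsHypothesis.Theorems.LacunarySymmetroidMatrixDescartesCensusSignVariationsFewnomial

/-!
# `MatrixDescartes` census — THEOREM N″: the window lemma WITH MULTIPLICITY, and the ONE-SLACK NEWTON LEMMA

HONEST FRAMING.  Object-search cell `pub-symmetroid`, route crux `Theses.LacunarySymmetroid.MatrixDescartes`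
(ledger item stmt-ValiantsHypothesis-18050).  ONE theorem about an arbitrary real fewnomial, refining the tree's
THEOREM N′ `Census.newton_window_of_alternating` (theory-2 g14; engine-6 g16 kernel) from DISTINCT positive roots
to positive roots COUNTED WITH MULTIPLICITY — the currency `f.roots.countP (0 < ·)` of Mathlib's Descartes rule
`Polynomial.roots_countP_pos_le_signVariations`:

`newton_window_of_alternating_countP` (THEOREM N″): for `f = Σ_{t<n} c_t X^{e_t}` (`n ≥ 3`, `e` strictly
increasing, all `c_t ≠ 0`) with `#{t : c_t c_{t+1} < 0} ≤ #Z₊^{mult}(f)` (by Descartes' rule this is equality: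
`f` is Descartes-sharp WITH MULTIPLICITY), every consecutive triple with `c_i c_{i+1} < 0`, `c_{i+1} c_{i+2} < 0`
satisfies the weighted Newton row
`(|c_i| W_i)^{e_{i+2}−e_{i+1}} · (|c_{i+2}| W_{i+2})^{e_{i+1}−e_i} ≤ (|c_{i+1}| W_{i+1})^{e_{i+2}−e_i}`,
`W_t = ∏_{u ≠ t} |e_t − e_u|`.  Since `#Z₊^{distinct} ≤ #Z₊^{mult}`, N″ implies N′.

COROLLARY `one_slack_newton` = engine-3 g15's **ONE-SLACK NEWTON LEMMA** (INBOX 2026-08-25T08:06:24Z; READER PASS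
referee g42, `referee/READER-ONESLACK-g42.md`; words of record R1029): an `n`-nomial with all `c_t ≠ 0`, exactly ONE
adjacent sign repetition `c_k c_{k+1} > 0`, and at least `n − 2` positive roots COUNTED WITH MULTIPLICITY satisfies
the Newton row (C25 row) at every adjacent triple whose centre is not `k` or `k+1`.  This is the V = 19 layer's
load-bearing lemma (R1029: «R2», the multiplicity clause, is what the door-A kit modes rest on): a symmetric 2×2
six-term pencil with 19 DISTINCT positive det-roots and 21 non-zero coefficients has V = 19 by parity, and its
det-roots counted with multiplicity number 19 or 20 — both covered by `#Z₊^{mult} ≥ n − 2`.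

COROLLARY `newton_window_of_le_countP` (NINETEEN FORM): the root count `n − 2 ≤ #Z₊^{mult}(f)` ALONE gives the
row at every alternating adjacent triple, wherever (and whether or not) the one possible repetition sits — by
«NO ODD SLACK» (`sum_alternating_eq_countP_of_le`, `…CensusSignVariationsFewnomial.lean`: Descartes with parity).
This covers engine-3's door-A corollary cases (A) (`n = 21`: 19 distinct roots ⇒ 19 or 20 with multiplicity) and
(B) (`n = 20`: one vanishing pair-sum coefficient) in one statement.

PROOF: the N′ induction verbatim («END KILLS ONLY»), in the multiplicity currency: an alternating end costs one root
(`countP_posRoots_le_countP_posRoots_twist_succ`, twisted Rolle with multiplicity), a non-alternating end costs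
nothing (`…_twist_of_endKill`, `…_topTwist_of_topKill`, multiplicity forms), and the surviving alternating trinomial
has two positive roots counted with multiplicity, where `trinomial_two_posRoots_le_of_countP` (a double root allowed)
is the inequality.  Nothing here bears on `ζ_sym`, `DoorA26`/`DoorA34`, the crux, or `VP ≠ VNP`.

[folklore] — the cell's own elementary theorems (theory-2 g14 N′; engine-3 g15 one-slack form), Rolle with
multiplicity and weighted AM–GM; no single source.
-/

-- `Summit.ValiantsHypothesis.ValiantsHypothesis.…` repeats a component by the D-0017 layout
-- (single-conjunct summit), which the `dupNamespace` linter flags; the name is mandated.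
set_option linter.dupNamespace false

namespace Summit.ValiantsHypothesis.ValiantsHypothesis.Theorems.LacunarySymmetroidMatrixDescartes.Census

open Polynomial Finset
open scoped BigOperators Polynomial

/-- **THEOREM N″ (WINDOW LEMMA WITH MULTIPLICITY, kernel).**  Let `f = Σ_{t<n} c_t X^{e_t}` (`n ≥ 3`, `e` strictly
increasing, all `c_t ≠ 0`) satisfy `#{t : c_t c_{t+1} < 0} ≤ #Z₊^{mult}(f) := f.roots.countP (0 < ·)` (positive
roots counted WITH MULTIPLICITY; by Descartes' rule `roots_countP_pos_le_signVariations` this is equality).  Then at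
every ALTERNATING consecutive triple `c_i c_{i+1} < 0`, `c_{i+1} c_{i+2} < 0` the weighted Newton row holds:
`(|c_i| W_i)^{e_{i+2}−e_{i+1}} · (|c_{i+2}| W_{i+2})^{e_{i+1}−e_i} ≤ (|c_{i+1}| W_{i+1})^{e_{i+2}−e_i}`,
`W_t = ∏_{u<n, u≠t} |e_t − e_u|` (product over `range n` with the `u = t` factor set to `1`).  Refines the tree's
`newton_window_of_alternating` (distinct roots).  PROOF: «END KILLS ONLY» in the multiplicity currency.
[folklore] -/
theorem newton_window_of_alternating_countP :
    ∀ (n : ℕ), 3 ≤ n → ∀ (e : ℕ → ℕ), StrictMono e → ∀ (c : ℕ → ℝ), (∀ t, t < n → c t ≠ 0) →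
      (∑ t ∈ range (n - 1), (if c t * c (t + 1) < 0 then 1 else 0)) ≤
        ((∑ t ∈ range n, C (c t) * X ^ (e t) : ℝ[X]).roots.countP (fun x => 0 < x)) →
      ∀ (i : ℕ), i + 2 < n → c i * c (i + 1) < 0 → c (i + 1) * c (i + 2) < 0 →
        (|c i| * ∏ u ∈ range n, (if u = i then 1 else |(e i : ℝ) - e u|)) ^ (e (i + 2) - e (i + 1)) *
          (|c (i + 2)| * ∏ u ∈ range n, (if u = i + 2 then 1 else |(e (i + 2) : ℝ) - e u|)) ^ (e (i + 1) - e i)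
        ≤ (|c (i + 1)| * ∏ u ∈ range n, (if u = i + 1 then 1 else |(e (i + 1) : ℝ) - e u|)) ^ (e (i + 2) - e i) := by
  intro n
  induction n using Nat.strong_induction_on with
  | _ n ih =>
  intro hn e he c hc hZ i hi h1 h2
  by_cases hn3 : n = 3
  · ------------------------------------------------------------ base: a trinomial with two positive roots
    subst hn3
    obtain rfl : i = 0 := by omega
    simp only [Nat.zero_add] at h1 h2 ⊢
    have he01 : e 0 < e 1 := he (by norm_num)
    have he12 : e 1 < e 2 := he (by norm_num)
    obtain ⟨a, ha⟩ : ∃ a, e 1 = e 0 + a := ⟨e 1 - e 0, by omega⟩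
    obtain ⟨b, hb⟩ : ∃ b, e 2 = e 1 + b := ⟨e 2 - e 1, by omega⟩
    have ha0 : 0 < a := by omega
    have hb0 : 0 < b := by omega
    -- two alternating pairs ⇒ two positive roots
    have hA : (∑ t ∈ range (3 - 1), (if c t * c (t + 1) < 0 then 1 else 0)) = 2 := by
      rw [show 3 - 1 = 2 from rfl, Finset.sum_range_succ, Finset.sum_range_succ, Finset.sum_range_zero,
        if_pos h1, if_pos h2]
    rw [hA] at hZ
    have hf3 : (∑ t ∈ range 3, C (c t) * X ^ (e t) : ℝ[X])
        = C (c 0) * X ^ (e 0) + C (c 1) * X ^ (e 0 + a) + C (c 2) * X ^ (e 0 + a + b) := by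
      rw [show e 0 + a + b = e 2 by omega, show e 0 + a = e 1 by omega,
        Finset.sum_range_succ, Finset.sum_range_succ, Finset.sum_range_succ, Finset.sum_range_zero, zero_add]
    rw [hf3] at hZ
    have htri := trinomial_two_posRoots_le_of_countP (i := e 0) ha0 hb0 (c 0) (c 1) (c 2) hZ
    -- weights: W0 = a(a+b), W1 = ab, W2 = (a+b)b
    have hab : (0 : ℝ) < a := by exact_mod_cast ha0
    have hbb : (0 : ℝ) < b := by exact_mod_cast hb0
    have c1r : ((e 1 : ℕ) : ℝ) = (e 0 : ℝ) + a := by rw [ha]; push_cast; ring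
    have c2r : ((e 2 : ℕ) : ℝ) = (e 0 : ℝ) + a + b := by rw [hb, ha]; push_cast; ring
    have hW0 : (∏ u ∈ range 3, (if u = 0 then 1 else |(e 0 : ℝ) - e u|)) = (a : ℝ) * (a + b) := by
      rw [Finset.prod_range_succ, Finset.prod_range_succ, Finset.prod_range_succ, Finset.prod_range_zero,
        if_pos rfl, if_neg (by norm_num), if_neg (by norm_num), c1r, c2r,
        show ((e 0 : ℝ) - ((e 0 : ℝ) + a)) = -a by ring, show ((e 0 : ℝ) - ((e 0 : ℝ) + a + b)) = -(a + b) by ring,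
        abs_neg, abs_neg, abs_of_pos hab, abs_of_pos (by positivity)]
      ring
    have hW1 : (∏ u ∈ range 3, (if u = 1 then 1 else |(e 1 : ℝ) - e u|)) = (a : ℝ) * b := by
      rw [Finset.prod_range_succ, Finset.prod_range_succ, Finset.prod_range_succ, Finset.prod_range_zero,
        if_neg (by norm_num), if_pos rfl, if_neg (by norm_num), c1r, c2r,
        show ((e 0 : ℝ) + a - e 0) = a by ring, show ((e 0 : ℝ) + a - ((e 0 : ℝ) + a + b)) = -b by ring, abs_neg,
        abs_of_pos hab, abs_of_pos hbb]
      ring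
    have hW2 : (∏ u ∈ range 3, (if u = 2 then 1 else |(e 2 : ℝ) - e u|)) = ((a : ℝ) + b) * b := by
      rw [Finset.prod_range_succ, Finset.prod_range_succ, Finset.prod_range_succ, Finset.prod_range_zero,
        if_neg (by norm_num), if_neg (by norm_num), if_pos rfl, c1r, c2r,
        show ((e 0 : ℝ) + a + b - e 0) = a + b by ring, show ((e 0 : ℝ) + a + b - ((e 0 : ℝ) + a)) = b by ring,
        abs_of_pos (by positivity), abs_of_pos hbb]
      ring
    rw [hW0, hW1, hW2, show e 2 - e 1 = b by omega, show e 1 - e 0 = a by omega, show e 2 - e 0 = a + b by omega]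
    -- `htri : (a+b)^{a+b} |c0|^b |c2|^a ≤ |c1|^{a+b} a^a b^b`; multiply by `a^b b^a`
    calc (|c 0| * ((a : ℝ) * (a + b))) ^ b * (|c 2| * (((a : ℝ) + b) * b)) ^ a
        = (((a : ℝ) + b) ^ (a + b) * |c 0| ^ b * |c 2| ^ a) * ((a : ℝ) ^ b * (b : ℝ) ^ a) := by
          rw [mul_pow, mul_pow, mul_pow, mul_pow, pow_add]; ring
      _ ≤ (|c 1| ^ (a + b) * (a : ℝ) ^ a * (b : ℝ) ^ b) * ((a : ℝ) ^ b * (b : ℝ) ^ a) :=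
          mul_le_mul_of_nonneg_right htri (by positivity)
      _ = (|c 1| * ((a : ℝ) * b)) ^ (a + b) := by rw [mul_pow, mul_pow, pow_add, pow_add]; ring
  · ------------------------------------------------------------ step: kill an end term outside the triple
    obtain ⟨k, rfl⟩ : ∃ k, n = k + 1 := ⟨n - 1, by omega⟩
    simp only [Nat.add_sub_cancel] at hZ
    have hk3 : 3 ≤ k := by omega
    have hei1 : e i < e (i + 1) := he (by omega)
    have hei2 : e (i + 1) < e (i + 2) := he (by omega)
    set f : ℝ[X] := ∑ t ∈ range (k + 1), C (c t) * X ^ (e t) with hf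
    by_cases hi1 : 1 ≤ i
    · ---------------------------------------------------------- bottom kill (index 0 ∉ triple)
      set E : ℝ := (e 0 : ℝ) with hE
      set c' : ℕ → ℝ := fun t => c (t + 1) * ((e (t + 1) : ℝ) - e 0) with hc'
      set e' : ℕ → ℕ := fun t => e (t + 1) with he'
      have he'm : StrictMono e' := fun a b hab => he (by simpa using hab)
      have hq : ∀ t, 0 < ((e (t + 1) : ℝ) - e 0) := by
        intro t
        have h' : e 0 < e (t + 1) := he (by omega)
        have h'' : (e 0 : ℝ) < e (t + 1) := by exact_mod_cast h'
        linarith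
      have hc'ne : ∀ t, t < k → c' t ≠ 0 := fun t ht => mul_ne_zero (hc (t + 1) (by omega)) (hq t).ne'
      have hsgn : ∀ t, (c' t * c' (t + 1) < 0 ↔ c (t + 1) * c (t + 1 + 1) < 0) := by
        intro t
        have hp := mul_pos (hq t) (hq (t + 1))
        have eq : c' t * c' (t + 1) = (c (t + 1) * c (t + 1 + 1)) * (((e (t + 1) : ℝ) - e 0) * ((e (t + 1 + 1) : ℝ) - e 0)) := by
          simp only [hc']; ring
        rw [eq]
        constructor
        · intro h; by_contra hge; rw [not_lt] at hge
          have := mul_nonneg hge hp.le; linarith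
        · intro h; exact mul_neg_of_neg_of_pos h hp
      -- the twisted polynomial is the `k`-term fewnomial with data `(e', c')`
      have hg : X * derivative f - C E * f = ∑ t ∈ range k, C (c' t) * X ^ (e' t) := by
        rw [hf, twist_rsum, Finset.sum_range_succ']
        simp only [hc', he', hE, sub_self, mul_zero, map_zero, zero_mul, add_zero]
      -- root count of the twist
      have he01 : e 0 < e 1 := he (by norm_num)
      have hZg : (∑ t ∈ range (k - 1), (if c' t * c' (t + 1) < 0 then 1 else 0)) ≤
          ((∑ t ∈ range k, C (c' t) * X ^ (e' t) : ℝ[X]).roots.countP (fun x => 0 < x)) := by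
        rw [← hg]
        have hsplit : (∑ t ∈ range k, (if c t * c (t + 1) < 0 then 1 else 0))
            = (if c 0 * c 1 < 0 then 1 else 0) + ∑ t ∈ range (k - 1), (if c' t * c' (t + 1) < 0 then 1 else 0) := by
          obtain ⟨k', hk'⟩ : ∃ k', k = k' + 1 := ⟨k - 1, by omega⟩
          rw [hk', Finset.sum_range_succ', Nat.add_sub_cancel, add_comm]
          congr 1
          exact Finset.sum_congr rfl fun t _ => by simp only [hsgn]
        rw [hsplit] at hZ
        by_cases h01 : c 0 * c 1 < 0
        · rw [if_pos h01] at hZ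
          have := countP_posRoots_le_countP_posRoots_twist_succ f E
          omega
        · rw [if_neg h01, zero_add] at hZ
          have h01' : 0 < c 0 * c 1 :=
            lt_of_le_of_ne (not_lt.mp h01) (Ne.symm (mul_ne_zero (hc 0 (by omega)) (hc 1 (by omega))))
          have hlow : ∀ j, j < e 0 → f.coeff j = 0 := by
            intro j hj; apply coeff_rsum_eq_zero; intro t _ hte
            have : e 0 ≤ e t := he.monotone (Nat.zero_le t); omega
          have hgap : ∀ j, e 0 < j → j < e 0 + (e 1 - e 0) → f.coeff j = 0 := by
            intro j hj1 hj2; apply coeff_rsum_eq_zero; intro t _ hte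
            rcases Nat.lt_or_ge t 1 with h0 | h1'
            · have ht0 : t = 0 := by omega
              subst ht0; omega
            · have : e 1 ≤ e t := he.monotone h1'; omega
          have hsame : 0 < f.coeff (e 0) * f.coeff (e 0 + (e 1 - e 0)) := by
            rw [show e 0 + (e 1 - e 0) = e 1 by omega, coeff_rsum_self e he c (show 0 < k + 1 by omega),
              coeff_rsum_self e he c (show 1 < k + 1 by omega)]; exact h01'
          have hek := countP_posRoots_le_countP_posRoots_twist_of_endKill f (show 1 ≤ e 1 - e 0 by omega) hlow hgap hsame
          exact hZ.trans hek
      -- induction hypothesis on the `k`-term fewnomial, triple `(i-1, i, i+1)`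
      have h1' : c' (i - 1) * c' (i - 1 + 1) < 0 := by
        rw [hsgn, show i - 1 + 1 = i by omega]; exact h1
      have h2' : c' (i - 1 + 1) * c' (i - 1 + 2) < 0 := by
        rw [show i - 1 + 2 = i - 1 + 1 + 1 by omega, hsgn, show i - 1 + 1 = i by omega]; exact h2
      have hIH := ih k (by omega) hk3 e' he'm c' hc'ne hZg (i - 1) (by omega) h1' h2'
      -- translate weights: |c' t| W' t = |c (t+1)| W (t+1)
      have hWt : ∀ t, |c' t| * ∏ u ∈ range k, (if u = t then 1 else |(e' t : ℝ) - e' u|)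
            = |c (t + 1)| * ∏ u ∈ range (k + 1), (if u = t + 1 then 1 else |(e (t + 1) : ℝ) - e u|) := by
        intro t
        rw [Finset.prod_range_succ']
        simp only [hc', he', show (0 : ℕ) ≠ t + 1 by omega, if_false, abs_mul, abs_of_pos (hq t),
          Nat.succ_inj]
        ring
      rw [show i - 1 + 2 = i + 1 by omega, show i - 1 + 1 = i by omega, hWt, hWt, hWt] at hIH
      simp only [he'] at hIH
      rw [show i - 1 + 1 = i by omega, show i + 1 + 1 = i + 2 by omega] at hIH
      exact hIH
    · ---------------------------------------------------------- top kill (index k ∉ triple, since i = 0, k ≥ 3)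
      obtain rfl : i = 0 := by omega
      simp only [Nat.zero_add] at h1 h2 hei1 hei2 ⊢
      set E : ℝ := (e k : ℝ) with hE
      set c' : ℕ → ℝ := fun t => c t * ((e t : ℝ) - e k) with hc'
      have hq : ∀ t, t < k → ((e t : ℝ) - e k) < 0 := by
        intro t ht
        have h' : e t < e k := he ht
        have h'' : (e t : ℝ) < e k := by exact_mod_cast h'
        linarith
      have hc'ne : ∀ t, t < k → c' t ≠ 0 := fun t ht => mul_ne_zero (hc t (by omega)) (hq t ht).ne
      have hsgn : ∀ t, t + 1 < k → (c' t * c' (t + 1) < 0 ↔ c t * c (t + 1) < 0) := by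
        intro t ht
        have hp := mul_pos_of_neg_of_neg (hq t (by omega)) (hq (t + 1) ht)
        have eq : c' t * c' (t + 1) = (c t * c (t + 1)) * (((e t : ℝ) - e k) * ((e (t + 1) : ℝ) - e k)) := by
          simp only [hc']; ring
        rw [eq]
        constructor
        · intro h; by_contra hge; rw [not_lt] at hge
          have := mul_nonneg hge hp.le; linarith
        · intro h; exact mul_neg_of_neg_of_pos h hp
      have hg : X * derivative f - C E * f = ∑ t ∈ range k, C (c' t) * X ^ (e t) := by
        rw [hf, twist_rsum, Finset.sum_range_succ]
        simp only [hc', hE, sub_self, mul_zero, map_zero, zero_mul, add_zero]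
      have hZg : (∑ t ∈ range (k - 1), (if c' t * c' (t + 1) < 0 then 1 else 0)) ≤
          ((∑ t ∈ range k, C (c' t) * X ^ (e t) : ℝ[X]).roots.countP (fun x => 0 < x)) := by
        rw [← hg]
        obtain ⟨k', hk'⟩ : ∃ k', k = k' + 1 := ⟨k - 1, by omega⟩
        have hsplit : (∑ t ∈ range k, (if c t * c (t + 1) < 0 then 1 else 0))
            = (∑ t ∈ range (k - 1), (if c' t * c' (t + 1) < 0 then 1 else 0)) +
              (if c k' * c (k' + 1) < 0 then 1 else 0) := by
          rw [hk', Finset.sum_range_succ, Nat.add_sub_cancel]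
          congr 1
          exact Finset.sum_congr rfl fun t ht => by
            have ht' := mem_range.mp ht
            simp only [hsgn t (by omega)]
        rw [hsplit] at hZ
        by_cases htop : c k' * c (k' + 1) < 0
        · rw [if_pos htop] at hZ
          have := countP_posRoots_le_countP_posRoots_twist_succ f E
          omega
        · rw [if_neg htop, add_zero] at hZ
          have htop' : 0 < c k' * c (k' + 1) :=
            lt_of_le_of_ne (not_lt.mp htop) (Ne.symm (mul_ne_zero (hc k' (by omega)) (hc (k' + 1) (by omega))))
          have hdeg : f.natDegree = e k := by
            have := natDegree_rsum (show 1 ≤ k + 1 by omega) e he c (by rw [Nat.add_sub_cancel]; exact hc k (by omega))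
            rw [Nat.add_sub_cancel] at this; exact this
          have hlead : f.leadingCoeff = c k := by
            rw [leadingCoeff, hdeg, coeff_rsum_self e he c (show k < k + 1 by omega)]
          have hem : e k' < e k := he (by omega)
          have hgap : ∀ j, f.natDegree - (e k - e k') < j → j < f.natDegree → f.coeff j = 0 := by
            intro j hj1 hj2; rw [hdeg] at hj1 hj2
            apply coeff_rsum_eq_zero; intro t ht hte
            rcases Nat.lt_or_ge t k' with hlt | hge
            · have : e t < e k' := he hlt; omega
            · rcases Nat.lt_or_ge t k with hlt2 | hge2
              · have htk : t = k' := by omega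
                subst htk; omega
              · have htk : t = k := by omega
                subst htk; omega
          have hsame : 0 < f.leadingCoeff * f.coeff (f.natDegree - (e k - e k')) := by
            have hkk : k' + 1 = k := by omega
            rw [hlead, hdeg, show e k - (e k - e k') = e k' by omega,
              coeff_rsum_self e he c (show k' < k + 1 by omega), mul_comm]
            rw [hkk] at htop'; exact htop'
          have htk := countP_posRoots_le_countP_posRoots_topTwist_of_topKill f (show 1 ≤ e k - e k' by omega)
            (by rw [hdeg]; omega) hgap hsame
          rw [hdeg] at htk
          exact hZ.trans htk
      have h1' : c' 0 * c' (0 + 1) < 0 := by rw [hsgn 0 (by omega)]; exact h1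
      have h2' : c' (0 + 1) * c' (0 + 2) < 0 := by rw [Nat.zero_add, hsgn 1 (by omega)]; exact h2
      have hIH := ih k (by omega) hk3 e he c' hc'ne hZg 0 (by omega) h1' h2'
      have hWt : ∀ t, t < k → |c' t| * ∏ u ∈ range k, (if u = t then 1 else |(e t : ℝ) - e u|)
            = |c t| * ∏ u ∈ range (k + 1), (if u = t then 1 else |(e t : ℝ) - e u|) := by
        intro t ht
        rw [Finset.prod_range_succ, if_neg (by omega)]
        simp only [hc', abs_mul]
        rw [abs_of_neg (hq t ht)]
        ring
      simp only [Nat.zero_add] at hIH ⊢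
      rw [hWt 0 (by omega), hWt 1 (by omega), hWt 2 (by omega)] at hIH
      exact hIH

/-- **ONE-SLACK NEWTON LEMMA (engine-3 g15; READER PASS referee g42, R1029) — kernel form.**  Let
`f = Σ_{t<n} c_t X^{e_t}` (`n ≥ 3`, `e` strictly increasing, all `c_t ≠ 0`) have EXACTLY ONE adjacent sign
repetition, at `k` (`c_k c_{k+1} > 0`, all other adjacent pairs alternating — so `V(f) = n − 2`), and at least
`n − 2` positive roots COUNTED WITH MULTIPLICITY.  Then the weighted Newton row (the C25 row, exponentiated)
holds at every adjacent triple `(i, i+1, i+2)` whose centre `i + 1` is neither `k` nor `k + 1`: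
`(|c_i| W_i)^{e_{i+2}−e_{i+1}} · (|c_{i+2}| W_{i+2})^{e_{i+1}−e_i} ≤ (|c_{i+1}| W_{i+1})^{e_{i+2}−e_i}`,
`W_t = ∏_{u ≠ t} |e_t − e_u|`; the two rows centred at `k`, `k+1` carry no constraint.  (Corollary of THEOREM N″
`newton_window_of_alternating_countP`: the alternation count is `n − 2`.)  In log form this is
`Δ₂·a_i + Δ₁·a_{i+2} ≤ (Δ₁+Δ₂)·a_{i+1}`, `a_t = log|c_t| + Σ_{u≠t} log|e_t − e_u|`, `Δ₁ = e_{i+1} − e_i`,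
`Δ₂ = e_{i+2} − e_{i+1}` — engine-3's wording. [folklore] -/
theorem one_slack_newton {n : ℕ} (hn : 3 ≤ n) (e : ℕ → ℕ) (he : StrictMono e) (c : ℕ → ℝ)
    (hc : ∀ t, t < n → c t ≠ 0) {k : ℕ} (hk : k + 1 < n) (hrep : 0 < c k * c (k + 1))
    (halt : ∀ t, t + 1 < n → t ≠ k → c t * c (t + 1) < 0)
    (hZ : n - 2 ≤ (∑ t ∈ range n, C (c t) * X ^ (e t) : ℝ[X]).roots.countP (fun x => 0 < x))
    {i : ℕ} (hi : i + 2 < n) (hik : i ≠ k) (hik' : i + 1 ≠ k) :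
    (|c i| * ∏ u ∈ range n, (if u = i then 1 else |(e i : ℝ) - e u|)) ^ (e (i + 2) - e (i + 1)) *
      (|c (i + 2)| * ∏ u ∈ range n, (if u = i + 2 then 1 else |(e (i + 2) : ℝ) - e u|)) ^ (e (i + 1) - e i)
    ≤ (|c (i + 1)| * ∏ u ∈ range n, (if u = i + 1 then 1 else |(e (i + 1) : ℝ) - e u|)) ^ (e (i + 2) - e i) := by
  -- the alternation count is exactly `n − 2`
  have hcount : (∑ t ∈ range (n - 1), (if c t * c (t + 1) < 0 then 1 else 0)) = n - 2 := by
    rw [Finset.sum_boole]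
    have hfilter : (range (n - 1)).filter (fun t => c t * c (t + 1) < 0) = (range (n - 1)).erase k := by
      ext t
      simp only [Finset.mem_filter, Finset.mem_erase, Finset.mem_range]
      constructor
      · rintro ⟨ht, hlt⟩
        refine ⟨?_, ht⟩
        rintro rfl
        linarith
      · rintro ⟨htk, ht⟩
        exact ⟨ht, halt t (by omega) htk⟩
    rw [hfilter, Finset.card_erase_of_mem (Finset.mem_range.mpr (by omega)), Finset.card_range]
    push_cast
    omega
  have hZ' : (∑ t ∈ range (n - 1), (if c t * c (t + 1) < 0 then 1 else 0)) ≤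
      (∑ t ∈ range n, C (c t) * X ^ (e t) : ℝ[X]).roots.countP (fun x => 0 < x) := by
    rw [hcount]; exact hZ
  exact newton_window_of_alternating_countP n hn e he c hc hZ' i hi (halt i (by omega) hik)
    (halt (i + 1) (by omega) hik')

/-- **WINDOW LEMMA, NINETEEN FORM.**  Let `f = Σ_{t<n} c_t X^{e_t}` (`n ≥ 3`, `e` strictly increasing, all
`c_t ≠ 0`) have at least `n − 2` positive roots COUNTED WITH MULTIPLICITY.  Then the weighted Newton row
`(|c_i| W_i)^{e_{i+2}−e_{i+1}} · (|c_{i+2}| W_{i+2})^{e_{i+1}−e_i} ≤ (|c_{i+1}| W_{i+1})^{e_{i+2}−e_i}`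
(`W_t = ∏_{u≠t} |e_t − e_u|`) holds at EVERY alternating adjacent triple `c_i c_{i+1} < 0`, `c_{i+1} c_{i+2} < 0` —
with no hypothesis on where, or whether, a sign repetition occurs (there is at most one, by
`card_nonalternating_le_one_of_le`).  This is engine-3 g15's COROLLARY (door A, (2,6)) at the fewnomial level:
case (A) is `n = 21` (19 distinct roots ⇒ 19 or 20 with multiplicity ≥ n − 2), case (B) is `n = 20`
(one vanishing pair-sum coefficient, 19 roots ≥ n − 2, all triples alternating). [folklore] -/
theorem newton_window_of_le_countP {n : ℕ} (hn : 3 ≤ n) (e : ℕ → ℕ) (he : StrictMono e) (c : ℕ → ℝ)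
    (hc : ∀ t, t < n → c t ≠ 0)
    (hZ : n - 2 ≤ (∑ t ∈ range n, C (c t) * X ^ (e t) : ℝ[X]).roots.countP (fun x => 0 < x))
    {i : ℕ} (hi : i + 2 < n) (h1 : c i * c (i + 1) < 0) (h2 : c (i + 1) * c (i + 2) < 0) :
    (|c i| * ∏ u ∈ range n, (if u = i then 1 else |(e i : ℝ) - e u|)) ^ (e (i + 2) - e (i + 1)) *
      (|c (i + 2)| * ∏ u ∈ range n, (if u = i + 2 then 1 else |(e (i + 2) : ℝ) - e u|)) ^ (e (i + 1) - e i)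
    ≤ (|c (i + 1)| * ∏ u ∈ range n, (if u = i + 1 then 1 else |(e (i + 1) : ℝ) - e u|)) ^ (e (i + 2) - e i) :=
  newton_window_of_alternating_countP n hn e he c hc
    (le_of_eq (sum_alternating_eq_countP_of_le (by omega) e he c hc hZ)) i hi h1 h2

end Summit.ValiantsHypothesis.ValiantsHypothesis.Theorems.LacunarySymmetroidMatrixDescartes.Census
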